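/-
Copyright: rh-split cell (nb-bridge g2). HONEST LABEL: SPLITTING SEARCH over kernel-typed RH-EQUIVALENCES;
nothing in this file bears on the truth of RH.
-/
import Literature.Barriers.RiemannHypothesis.BettinGonek2017Thm2Proofs
import Literature.Barriers.RiemannHypothesis.BettinGonek2017LowerBoundProofs
import Literature.NumberTheory.LFunctions.BettinConreyFarmer2013
import Summits.RiemannHypothesis.RiemannHypothesis.Theorems.NymanBeurlingNbMoebiusLevinson
import HarnessLib

/-!
# NB growth detectors (rh-split, family nb, lens bridge, target T11 ⟸)

`C ⟹ RH` detectors whose hypothesis `C` is a GROWTH bound for the Báez-Duarte–Bettin–Conrey–Farmer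
distance `bcfDistSq N = (1/2π) ∫ |1 - ζ V_N|²(½+it) dt/(¼+t²)` of the natural approximants
`V_N = levinsonMollifier N` (dictionary `nbMoebius_sum_eq_levinsonMollifier`):

* `two_mul_re_le_of_bcfDistSq_le_rpow` : `bcfDistSq N ≤ C·N^δ (N ≥ 2)` forces `2·Re ρ ≤ 1 + δ` for
  every zero `ρ` with `Re ρ ≥ 1/2` (graded / quasi-RH form: `quasiRH_of_bcfDistSq_le_rpow`);
* `riemannHypothesis_of_bcfDistSq_subpolynomial` : `bcfDistSq N = N^{o(1)}` forces RH.

Engine: the Bettin–Gonek 2017 §2 lower bound at an off-line zero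
(`BettinGonek2017_lowerBound_holds`, kernel) integrated over the FIXED height block `t ∈ [0,1]`
(`BettinGonek2017_lowerBound_integrated_Icc`, `integral_norm_sq_riemannZeta_pos`) and the elementary
comparison `I_N(0,1) ≤ 2 + 5π·bcfDistSq N` (`mollifiedSecondMoment_zero_one_le`). No height
asymptotics, no moment hypothesis. The hypothesis `C` is NOT RH-free (it is a statement about ζ's own
NB distance); these are detectors, not splittings. Raw quantified forms only (no new definitions).
[cite: BettinGonek2017, §2; BettinConreyFarmer2013, (1)–(3); BaezDuarte2003]

HONEST LABEL: «SPLITTING SEARCH over kernel-typed RH-EQUIVALENCES; a splitting A ∧ B ⟹ RH is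
CONDITIONAL bookkeeping unless A and B are both proved; nothing here bears on the truth of RH.»
-/

set_option linter.dupNamespace false

noncomputable section

open Complex MeasureTheory Real

namespace Summit.RiemannHypothesis.RiemannHypothesis.Theorems.Splittings.NbGrowthDetectors

open Literature.Barriers.RiemannHypothesis
open Literature.NumberTheory.LFunctions (bcfDistSq bcfDistSq_nonneg continuous_riemannZeta_line)
open Summit.RiemannHypothesis.RiemannHypothesis.Theorems (nbMoebius_sum_eq_levinsonMollifier
  integrable_nbIntegrand)

/-- The NB integrand of the natural approximants is integrable (tree: `integrable_nbIntegrand` +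
the dictionary `nbMoebius_sum_eq_levinsonMollifier`). [folklore] -/
theorem integrable_levinson_nbIntegrand (N : ℕ) :
    Integrable fun t : ℝ ↦ ‖1 - riemannZeta (1 / 2 + t * I) *
        levinsonMollifier N (1 / 2 + t * I)‖ ^ 2 / (1 / 4 + t ^ 2) := by
  have h := integrable_nbIntegrand (N := N) fun n ↦
    ((ArithmeticFunction.moebius (n + 1) : ℝ) * (1 - Real.log ((n : ℝ) + 1) / Real.log N) : ℂ)
  simpa only [nbMoebius_sum_eq_levinsonMollifier] using h

/-- `|M|²|ζ|² = |ζM|² ≤ 2 + 2|1 - ζM|²`. [folklore] -/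
theorem norm_sq_mul_le (z m : ℂ) : ‖m‖ ^ 2 * ‖z‖ ^ 2 ≤ 2 + 2 * ‖1 - z * m‖ ^ 2 := by
  have h1 : ‖z * m‖ ≤ 1 + ‖1 - z * m‖ := by
    calc ‖z * m‖ = ‖(1 : ℂ) - (1 - z * m)‖ := by congr 1; ring
      _ ≤ ‖(1 : ℂ)‖ + ‖1 - z * m‖ := norm_sub_le _ _
      _ = 1 + ‖1 - z * m‖ := by simp
  have h2 : ‖m‖ ^ 2 * ‖z‖ ^ 2 = ‖z * m‖ ^ 2 := by rw [norm_mul]; ring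
  rw [h2]
  nlinarith [h1, sq_nonneg (1 - ‖1 - z * m‖), norm_nonneg (z * m), norm_nonneg (1 - z * m)]

/-- **Block moment ≤ NB distance.** `I_N(0,1) = ∫_0^1 |M_N ζ|²(½+it) dt ≤ 2 + 5π · bcfDistSq N`
(pointwise `|ζM|² ≤ 2 + 2|1 - ζM|²` and `1 ≤ (5/4)/(1/4+t²)` on `[0,1]`). [folklore] -/
theorem mollifiedSecondMoment_zero_one_le (N : ℕ) :
    mollifiedSecondMoment N 0 1 ≤ 2 + 5 * π * bcfDistSq N := by
  set g : ℝ → ℝ := fun t ↦ ‖1 - riemannZeta (1 / 2 + t * I) *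
        levinsonMollifier N (1 / 2 + t * I)‖ ^ 2 / (1 / 4 + t ^ 2) with hg
  set f : ℝ → ℝ := fun t ↦ ‖levinsonMollifier N (1 / 2 + t * I)‖ ^ 2 *
      ‖riemannZeta (1 / 2 + t * I)‖ ^ 2 with hf
  have hgint : Integrable g := integrable_levinson_nbIntegrand N
  have hline : Continuous fun t : ℝ ↦ (1 / 2 : ℂ) + t * I := by fun_prop
  have hfc : Continuous f :=
    ((continuous_levinsonMollifier_criticalLine N).norm.pow 2).mul
      (continuous_riemannZeta_line.norm.pow 2)
  -- pointwise comparison on `[0,1]`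
  have hpt : ∀ t ∈ Set.Icc (0 : ℝ) 1, f t ≤ 2 + 5 / 2 * g t := by
    intro t ht
    have hA := norm_sq_mul_le (riemannZeta (1 / 2 + t * I)) (levinsonMollifier N (1 / 2 + t * I))
    have hpos : (0 : ℝ) < 1 / 4 + t ^ 2 := by positivity
    have h54 : (1 / 4 : ℝ) + t ^ 2 ≤ 5 / 4 := by
      have h0 : 0 ≤ t := ht.1
      nlinarith [ht.2]
    have hE : ‖1 - riemannZeta (1 / 2 + t * I) * levinsonMollifier N (1 / 2 + t * I)‖ ^ 2 =
        g t * (1 / 4 + t ^ 2) := by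
      simp only [hg]; exact (div_mul_cancel₀ _ hpos.ne').symm
    have hg0 : 0 ≤ g t := by simp only [hg]; positivity
    have hB : ‖1 - riemannZeta (1 / 2 + t * I) * levinsonMollifier N (1 / 2 + t * I)‖ ^ 2 ≤
        g t * (5 / 4) := by rw [hE]; exact mul_le_mul_of_nonneg_left h54 hg0
    have hft : f t = ‖levinsonMollifier N (1 / 2 + t * I)‖ ^ 2 *
        ‖riemannZeta (1 / 2 + t * I)‖ ^ 2 := rfl
    rw [hft]
    linarith
  -- integrate over `[0,1]`
  have hfi : IntervalIntegrable f volume 0 1 := hfc.intervalIntegrable _ _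
  have hri : IntervalIntegrable (fun t ↦ 2 + 5 / 2 * g t) volume 0 1 :=
    (intervalIntegrable_const).add (hgint.intervalIntegrable.const_mul _)
  have hmono := intervalIntegral.integral_mono_on zero_le_one hfi hri hpt
  have hsplit : ∫ t in (0 : ℝ)..1, (2 + 5 / 2 * g t) = 2 + 5 / 2 * ∫ t in (0 : ℝ)..1, g t := by
    rw [intervalIntegral.integral_add intervalIntegrable_const
      (hgint.intervalIntegrable.const_mul _), intervalIntegral.integral_const,
      intervalIntegral.integral_const_mul]
    simp
  have hsub : ∫ t in (0 : ℝ)..1, g t ≤ ∫ t, g t := by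
    rw [intervalIntegral.integral_of_le zero_le_one]
    exact setIntegral_le_integral hgint (Filter.Eventually.of_forall fun t ↦ by positivity)
  have hbcf : ∫ t, g t = 2 * π * bcfDistSq N := by
    have hπ : (2 : ℝ) * π ≠ 0 := by positivity
    have e : bcfDistSq N = 1 / (2 * π) * ∫ t, g t := rfl
    rw [e, ← mul_assoc, mul_one_div_cancel hπ, one_mul]
  have hI : mollifiedSecondMoment N 0 1 = ∫ t in (0 : ℝ)..1, f t := rfl
  rw [hI]
  calc ∫ t in (0 : ℝ)..1, f t ≤ ∫ t in (0 : ℝ)..1, (2 + 5 / 2 * g t) := hmono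
    _ = 2 + 5 / 2 * ∫ t in (0 : ℝ)..1, g t := hsplit
    _ ≤ 2 + 5 / 2 * ∫ t, g t := by gcongr
    _ = 2 + 5 * π * bcfDistSq N := by rw [hbcf]; ring

/-- The growth constant is non-negative (since `bcfDistSq 2 ≥ 0`). [folklore] -/
theorem const_nonneg_of_bcfDistSq_le {δ C : ℝ} (hC : ∀ N : ℕ, 2 ≤ N → bcfDistSq N ≤ C * (N : ℝ) ^ δ) :
    0 ≤ C := by
  have h := (bcfDistSq_nonneg 2).trans (hC 2 le_rfl)
  have hpos : (0 : ℝ) < ((2 : ℕ) : ℝ) ^ δ := by positivity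
  by_contra hneg
  push Not at hneg
  have := mul_neg_of_neg_of_pos hneg hpos
  linarith

/-- **Graded detector.** If `bcfDistSq N ≤ C N^δ` for all `N ≥ 2` (`δ ≥ 0`), then every zero `ρ` of
`ζ` with `Re ρ ≥ 1/2` satisfies `2 Re ρ ≤ 1 + δ`. [cite: BettinGonek2017, §2 (engine)] -/
theorem two_mul_re_le_of_bcfDistSq_le_rpow {δ : ℝ} (hδ : 0 ≤ δ)
    (h : ∃ C : ℝ, ∀ N : ℕ, 2 ≤ N → bcfDistSq N ≤ C * (N : ℝ) ^ δ) {s : ℂ}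
    (hζ : riemannZeta s = 0) (hs : 1 / 2 ≤ s.re) : 2 * s.re ≤ 1 + δ := by
  by_contra hcon
  push Not at hcon
  obtain ⟨C, hC⟩ := h
  have hC0 : 0 ≤ C := const_nonneg_of_bcfDistSq_le hC
  have hβ1 := Literature.NumberTheory.LFunctions.re_lt_one_of_riemannZeta_eq_zero hζ
  set η : ℝ := (2 * s.re - 1 - δ) / 3 with hη
  have hη0 : 0 < η := by rw [hη]; linarith
  obtain ⟨c, hc, hlb⟩ := BettinGonek2017_lowerBound_holds s hζ hs
  set κ : ℝ := ∫ t in (0 : ℝ)..1, ‖riemannZeta (1 / 2 + t * I)‖ ^ 2 with hκ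
  have hκ0 : 0 < κ := integral_norm_sq_riemannZeta_pos
  set D : ℝ := 2 * (2 + 5 * π * C) / η ^ 2 with hD
  have hD0 : 0 ≤ D := by rw [hD]; positivity
  refine false_of_rpow_le (η := η) (B := 64 * D / (c * κ)) (T₀ := 4) hη0 fun T hT ↦ ?_
  have hT0 : 0 < T := by linarith
  have hT1 : 1 ≤ T := by linarith
  set x : ℝ := T / 2 with hx
  have hx2 : 2 ≤ x := by rw [hx]; linarith
  have hx0 : 0 < x := by linarith
  set K := ⌊x⌋₊ with hK
  have hKx : (K : ℝ) ≤ x := Nat.floor_le hx0.le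
  have hKT : ((K + 1 : ℕ) : ℝ) ≤ T := by push_cast; rw [hx] at hKx; linarith
  have hK1pos : (0 : ℝ) < ((K + 1 : ℕ) : ℝ) := by positivity
  -- (1) the integrated lower bound on the block `[0,1]`
  have h1 := BettinGonek2017_lowerBound_integrated_Icc (β := s.re) (T₁ := 0) (T₂ := 1) hx2 hc.le
    le_rfl zero_le_one (hlb x hx2)
  -- (2) the upper bound for the right-hand side
  have hterm : ∀ N ∈ Finset.Icc 1 (K + 1), Real.log N ^ 2 * mollifiedSecondMoment N 0 1 ≤
      Real.log ((K + 1 : ℕ) : ℝ) ^ 2 * (2 + 5 * π * C * ((K + 1 : ℕ) : ℝ) ^ δ) := by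
    intro N hN
    obtain ⟨hN1, hNK⟩ := Finset.mem_Icc.1 hN
    have hrhs0 : 0 ≤ 2 + 5 * π * C * ((K + 1 : ℕ) : ℝ) ^ δ := by positivity
    rcases eq_or_lt_of_le hN1 with h1' | h1'
    · subst h1'
      simp only [Nat.cast_one, Real.log_one, ne_eq, OfNat.ofNat_ne_zero, not_false_eq_true,
        zero_pow, zero_mul]
      exact mul_nonneg (sq_nonneg _) hrhs0
    · have hN2 : 2 ≤ N := by omega
      have hlog : Real.log N ^ 2 ≤ Real.log ((K + 1 : ℕ) : ℝ) ^ 2 := by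
        have h0 : 0 ≤ Real.log N := Real.log_nonneg (by exact_mod_cast hN1)
        have h1'' : Real.log N ≤ Real.log ((K + 1 : ℕ) : ℝ) :=
          Real.log_le_log (by exact_mod_cast (by omega : 0 < N)) (by exact_mod_cast hNK)
        nlinarith
      have hNd : (N : ℝ) ^ δ ≤ ((K + 1 : ℕ) : ℝ) ^ δ :=
        Real.rpow_le_rpow (by positivity) (by exact_mod_cast hNK) hδ
      have hmom : mollifiedSecondMoment N 0 1 ≤ 2 + 5 * π * C * ((K + 1 : ℕ) : ℝ) ^ δ := by
        calc mollifiedSecondMoment N 0 1 ≤ 2 + 5 * π * bcfDistSq N :=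
              mollifiedSecondMoment_zero_one_le N
          _ ≤ 2 + 5 * π * (C * (N : ℝ) ^ δ) := by gcongr; exact hC N hN2
          _ ≤ 2 + 5 * π * (C * ((K + 1 : ℕ) : ℝ) ^ δ) := by gcongr
          _ = 2 + 5 * π * C * ((K + 1 : ℕ) : ℝ) ^ δ := by ring
      exact mul_le_mul hlog hmom (mollifiedSecondMoment_nonneg N zero_le_one) (sq_nonneg _)
  have h2 : ∑ N ∈ Finset.Icc 1 (K + 1), Real.log N ^ 2 * mollifiedSecondMoment N 0 1 ≤
      ((K + 1 : ℕ) : ℝ) * (Real.log ((K + 1 : ℕ) : ℝ) ^ 2 *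
        (2 + 5 * π * C * ((K + 1 : ℕ) : ℝ) ^ δ)) := by
    calc ∑ N ∈ Finset.Icc 1 (K + 1), Real.log N ^ 2 * mollifiedSecondMoment N 0 1
        ≤ ∑ N ∈ Finset.Icc 1 (K + 1), Real.log ((K + 1 : ℕ) : ℝ) ^ 2 *
            (2 + 5 * π * C * ((K + 1 : ℕ) : ℝ) ^ δ) := Finset.sum_le_sum hterm
      _ = ((K + 1 : ℕ) : ℝ) * (Real.log ((K + 1 : ℕ) : ℝ) ^ 2 *
            (2 + 5 * π * C * ((K + 1 : ℕ) : ℝ) ^ δ)) := by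
          rw [Finset.sum_const, Nat.card_Icc, nsmul_eq_mul]; simp
  -- (3) sizes: everything in powers of `T`
  have hlogT : Real.log T ≤ T ^ η / η := Real.log_le_rpow_div hT0.le hη0
  have hlogK : Real.log ((K + 1 : ℕ) : ℝ) ≤ T ^ η / η :=
    (Real.log_le_log hK1pos hKT).trans hlogT
  have hlog0 : 0 ≤ Real.log ((K + 1 : ℕ) : ℝ) := Real.log_nonneg (by exact_mod_cast (by omega))
  have hKd : ((K + 1 : ℕ) : ℝ) ^ δ ≤ T ^ δ := Real.rpow_le_rpow hK1pos.le hKT hδ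
  have hTd1 : 1 ≤ T ^ δ := Real.one_le_rpow hT1 hδ
  have hrhs : 2 * (((K + 1 : ℕ) : ℝ) * (Real.log ((K + 1 : ℕ) : ℝ) ^ 2 *
        (2 + 5 * π * C * ((K + 1 : ℕ) : ℝ) ^ δ))) ≤ D * (T * (T ^ η) ^ 2 * T ^ δ) := by
    have h5 : 2 + 5 * π * C * ((K + 1 : ℕ) : ℝ) ^ δ ≤ (2 + 5 * π * C) * T ^ δ := by
      have : 5 * π * C * ((K + 1 : ℕ) : ℝ) ^ δ ≤ 5 * π * C * T ^ δ :=
        mul_le_mul_of_nonneg_left hKd (by positivity)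
      nlinarith
    calc 2 * (((K + 1 : ℕ) : ℝ) * (Real.log ((K + 1 : ℕ) : ℝ) ^ 2 *
          (2 + 5 * π * C * ((K + 1 : ℕ) : ℝ) ^ δ)))
        ≤ 2 * (T * ((T ^ η / η) ^ 2 * ((2 + 5 * π * C) * T ^ δ))) := by gcongr
      _ = D * (T * (T ^ η) ^ 2 * T ^ δ) := by rw [hD]; field_simp
  have hhalf : (1 / 4 : ℝ) ≤ (1 / 2 : ℝ) ^ (2 * s.re) := by
    calc (1 / 4 : ℝ) = (1 / 2 : ℝ) ^ (2 : ℝ) := by norm_num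
      _ ≤ (1 / 2 : ℝ) ^ (2 * s.re) :=
          Real.rpow_le_rpow_of_exponent_ge (by norm_num) (by norm_num) (by linarith)
  have hxpow : T ^ (2 * s.re) / 4 ≤ x ^ (2 * s.re) := by
    have e : x = T * (1 / 2) := by rw [hx]; ring
    rw [e, Real.mul_rpow hT0.le (by norm_num)]
    have := Real.rpow_nonneg hT0.le (2 * s.re)
    calc T ^ (2 * s.re) / 4 = T ^ (2 * s.re) * (1 / 4) := by ring
      _ ≤ T ^ (2 * s.re) * (1 / 2 : ℝ) ^ (2 * s.re) := by gcongr
  have hlhs : c * κ / 64 * T ^ (2 * s.re) ≤ c * x ^ (2 * s.re) / (1 + 1) ^ 4 * κ := by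
    calc c * κ / 64 * T ^ (2 * s.re) = c * (T ^ (2 * s.re) / 4) / 16 * κ := by ring
      _ ≤ c * x ^ (2 * s.re) / 16 * κ := by gcongr
      _ = c * x ^ (2 * s.re) / (1 + 1) ^ 4 * κ := by norm_num
  have hmain : c * κ / 64 * T ^ (2 * s.re) ≤ D * (T * (T ^ η) ^ 2 * T ^ δ) :=
    calc c * κ / 64 * T ^ (2 * s.re) ≤ c * x ^ (2 * s.re) / (1 + 1) ^ 4 * κ := hlhs
      _ ≤ 2 * ∑ N ∈ Finset.Icc 1 (K + 1), Real.log N ^ 2 * mollifiedSecondMoment N 0 1 := by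
          simpa only [hK, hκ] using h1
      _ ≤ 2 * (((K + 1 : ℕ) : ℝ) * (Real.log ((K + 1 : ℕ) : ℝ) ^ 2 *
          (2 + 5 * π * C * ((K + 1 : ℕ) : ℝ) ^ δ))) := by linarith [h2]
      _ ≤ D * (T * (T ^ η) ^ 2 * T ^ δ) := hrhs
  -- exponent bookkeeping: `2 re s = 1 + δ + 3η`
  have hexp : T * (T ^ η) ^ 2 * T ^ δ = T ^ (1 + 2 * η + δ) := by
    rw [show 1 + 2 * η + δ = 1 + η + η + δ by ring, Real.rpow_add hT0, Real.rpow_add hT0,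
      Real.rpow_add hT0, Real.rpow_one]; ring
  have hlhs' : T ^ (2 * s.re) = T ^ (1 + 2 * η + δ) * T ^ η := by
    rw [← Real.rpow_add hT0]; congr 1; rw [hη]; ring
  rw [hexp, hlhs'] at hmain
  have hpos : 0 < T ^ (1 + 2 * η + δ) := Real.rpow_pos_of_pos hT0 _
  have hcc : 0 < c * κ := mul_pos hc hκ0
  have hkey : c * κ / 64 * T ^ η ≤ D := by
    refine le_of_mul_le_mul_right ?_ hpos
    calc c * κ / 64 * T ^ η * T ^ (1 + 2 * η + δ)
        = c * κ / 64 * (T ^ (1 + 2 * η + δ) * T ^ η) := by ring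
      _ ≤ D * T ^ (1 + 2 * η + δ) := hmain
  rw [le_div_iff₀ hcc]
  have e : T ^ η * (c * κ) = 64 * (c * κ / 64 * T ^ η) := by ring
  rw [e]
  linarith

/-- **Subpolynomial NB distance of the natural approximants forces RH**:
`(∀ δ > 0, bcfDistSq N ≪_δ N^δ) → RiemannHypothesis`. [cite: BettinGonek2017, §2 (engine)] -/
theorem riemannHypothesis_of_bcfDistSq_subpolynomial
    (h : ∀ δ : ℝ, 0 < δ → ∃ C : ℝ, ∀ N : ℕ, 2 ≤ N → bcfDistSq N ≤ C * (N : ℝ) ^ δ) :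
    _root_.RiemannHypothesis := by
  refine Literature.NumberTheory.LFunctions.quasiRiemannHypothesis_one_half_iff_holds.1
    fun s hs h0 _ ↦ ?_
  have hδ : 0 < s.re - 1 / 2 := by linarith
  have := two_mul_re_le_of_bcfDistSq_le_rpow hδ.le (h _ hδ) hs h0.le
  linarith

/-- **Graded reading (quasi-RH).** `bcfDistSq N ≤ C N^δ (N ≥ 2)` gives the zero-free half-plane
`Re s > (1+δ)/2`, i.e. `QuasiRiemannHypothesis ((1+δ)/2)`. [cite: BettinGonek2017, §2 (engine)] -/
theorem quasiRH_of_bcfDistSq_le_rpow {δ : ℝ} (hδ : 0 ≤ δ)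
    (h : ∃ C : ℝ, ∀ N : ℕ, 2 ≤ N → bcfDistSq N ≤ C * (N : ℝ) ^ δ) :
    Literature.NumberTheory.LFunctions.QuasiRiemannHypothesis ((1 + δ) / 2) := by
  intro s hs h0 _
  have h12 : 1 / 2 ≤ s.re := by
    have : (1 : ℝ) / 2 ≤ (1 + δ) / 2 := by linarith
    linarith
  have := two_mul_re_le_of_bcfDistSq_le_rpow hδ h hs h12
  linarith

end Summit.RiemannHypothesis.RiemannHypothesis.Theorems.Splittings.NbGrowthDetectors
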